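import Mathlib
import Summits.HubbardSuperconductivity.HubbardSuperconductivity.Theorems.BalabanIRBirBdGPhaseCoercivityLyapunovCore
import Summits.HubbardSuperconductivity.HubbardSuperconductivity.Theorems.BalabanIRBirGappedPhaseReductionRBlockLondonSymbol
import Summits.HubbardSuperconductivity.HubbardSuperconductivity.Theorems.BalabanIRBirGappedPhaseReductionRBlockLondonJensen

/-!
# Route BalabanIR — crux 4R `BirGappedPhaseReductionR` (item `stmt-HubbardSuperconductivity-14846`):
# block-London coercivity III — the block (London) phase rigidity of the `d+id` BdG reference
# from a scalar inequality on its anomalous-amplitude symbol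

THEOREM (`blockLondon_of_kernelSymbolIneq`, the first stub of card `london-block-coercivity` of
this crux REDUCED to a symbol inequality; crux-3 vocabulary verbatim).  Fix `μ, Δ₁, Δ₂`, `L ≥ 3`,
the symbols `ξ_k, Δ_k, E_k = √(ξ_k² + |Δ_k|²)` of the hopping and `d+id` pairing stencils and a
uniform gap `0 < m ≤ E_k` (all exactly as in `lyap_core`), a block side `ℓ ∣ L` and `c ∈ ℝ`.  IF the
anomalous-amplitude symbol `f = Δ/E` satisfies, for every texture momentum `q`, the KERNEL SYMBOL
INEQUALITY
  `c · ℓ⁻² (|1 - χ_q(ℓe₀)|² + |1 - χ_q(ℓe₁)|²) ≤ N⁻¹ Σ_k |f_k - f_{k+q}|²`   (`N = L²`),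
THEN for every phase texture `θ` the block (London) misalignment of the card,
`blockMis(θ) = Σ_{b corner} (|m_b - m_{b+ℓe₀}|² + |m_b - m_{b+ℓe₁}|²)`, `m_b = ℓ⁻² Σ_{x∈b} e^{iθ_x}`,
is dominated by the BdG energy deficit:
  `(m c / 4) · blockMis(θ) ≤ Σ_i |λ_i(Hb 0)| - Σ_i |λ_i(Hb θ)|`.
PROOF. `lyap_core` ⇒ deficit `≥ (m/4) Σ_{xy} |F_{xy}|² |u_y - u_x|²` (`u = e^{iθ}`); in modes this is
`(m/4) N⁻² Σ_q |û(q)|² Σ_k |f_k - f_{k+q}|²` (`kernelFunctional_eq_modes`), which by the hypothesis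
dominates `(m/4) N⁻¹ Σ_q |û(q)|² · c ℓ⁻² Σᵢ |1 - χ_q(ℓeᵢ)|² = (m c/4) ℓ⁻² Σ_x Σᵢ |u_x - u_{x+ℓeᵢ}|²`
(`sum_normSq_sub_shift_eq_modes`) `≥ (m c/4) blockMis(θ)` (`blockMis_le_shift`).
WHY IT MATTERS (numbers, `work/london/symbol_check2.py` of prover seat 1, s8): at `μ = -1`,
`Δ₂ = Δ₁/2`, `ℓ ≈ 1.33 ξ` (`ξ = v_F/m`) the best constant `(m/4)·min_q S(q)/B(q)` is
`0.083 / 0.045 / 0.033 / 0.030 / 0.030` at `Δ₁ = 1/2, 1/4, 1/8, 1/16, 1/32` (`L = 48…192`,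
`L`-converged) — it PLATEAUS: the Lyapunov functional of crux 3 carries a GAP-UNIFORM block
constant, whereas the same functional against the lattice XY form gives `(m/4) min_q S/ε ∝ Δ²`
(`0.034 → 0.0027` from `Δ₁ = 1/2` to `1/8`).  So `BdGBlockLondonCoercivity` (card, `∃ c(μ) > 0`
independent of the gap) follows from a scalar inequality on explicit lattice sums, analysable as
`Δ → 0` (shell of width `1/ξ` around the Fermi curve) and certifiable pointwise.
No definition is introduced.
-/

noncomputable section

namespace Summit.HubbardSuperconductivity.HubbardSuperconductivity.Theorems

namespace BirBdG

open Matrix Finset Literature.Probability.LatticeModels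
open scoped ComplexConjugate ComplexOrder

/-- **Block-London phase rigidity of the `d+id` BdG reference from the kernel symbol inequality.**
See the module docstring. [folklore] -/
theorem blockLondon_of_kernelSymbolIneq : ∀ (L : ℕ) [NeZero L] (μ Δ₁ Δ₂ m c : ℝ) (ℓ : ℕ), 3 ≤ L → 0 < ℓ → ℓ ∣ L → ∀ (ξ E : Literature.Probability.LatticeModels.TorusSite 2 L → ℝ) (Δ : Literature.Probability.LatticeModels.TorusSite 2 L → ℂ), (∀ k, ξ k = -2 * Real.cos (Literature.Probability.LatticeModels.latticeMomentum L k 0) - 2 * Real.cos (Literature.Probability.LatticeModels.latticeMomentum L k 1) - μ) → (∀ k, Δ k = ((2 * Δ₁ * (Real.cos (Literature.Probability.LatticeModels.latticeMomentum L k 0) - Real.cos (Literature.Probability.LatticeModels.latticeMomentum L k 1)) : ℝ) : ℂ) - 4 * Complex.I * ((Δ₂ * Real.sin (Literature.Probability.LatticeModels.latticeMomentum L k 0) * Real.sin (Literature.Probability.LatticeModels.latticeMomentum L k 1) : ℝ) : ℂ)) → (∀ k, E k = Real.sqrt (ξ k ^ 2 + ‖Δ k‖ ^ 2)) → 0 <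 m → (∀ k, m ≤ E k) → (∀ q : Literature.Probability.LatticeModels.TorusSite 2 L, c * (((ℓ : ℝ) ^ 2)⁻¹ * (‖1 - Literature.Probability.LatticeModels.torusChar q ![((ℓ : ℕ) : ZMod L), 0]‖ ^ 2 + ‖1 - Literature.Probability.LatticeModels.torusChar q ![0, ((ℓ : ℕ) : ZMod L)]‖ ^ 2)) ≤ ((L ^ 2 : ℕ) : ℝ)⁻¹ * ∑ k : Literature.Probability.LatticeModels.TorusSite 2 L, ‖Δ k / (E k : ℂ) - Δ (k + q) / (E (k + q) : ℂ)‖ ^ 2) → let nnx : Literature.Probability.LatticeModels.TorusSite 2 L → Literature.Probability.LatticeModels.TorusSite 2 L → Prop := fun x y => y = x + ![1, 0] ∨ y = x + ![-1, 0]; let nny : Literature.Probability.LatticeModels.TorusSite 2 L → Literature.Probability.LatticeModels.TorusSite 2 L → Prop := fun x y => y = x + ![0, 1] ∨ y = x + ![0, -1]; let dg1 : Literature.Probability.LatticeModels.TorusSite 2 L → Literature.Probability.LatticeModels.TorusSite 2 L → Prop := fun x y => y = x + ![1, 1] ∨ y = x + ![-1, -1]; let dg2 : Literature.Probability.LatticeModels.TorusSite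 2 L → Literature.Probability.LatticeModels.TorusSite 2 L → Prop := fun x y => y = x + ![1, -1] ∨ y = x + ![-1, 1]; let h : Matrix (Literature.Probability.LatticeModels.TorusSite 2 L) (Literature.Probability.LatticeModels.TorusSite 2 L) ℂ := fun x y => -(if nnx x y ∨ nny x y then (1 : ℂ) else 0) - (if x = y then (μ : ℂ) else 0); let D : (Literature.Probability.LatticeModels.TorusSite 2 L → ℝ) → Matrix (Literature.Probability.LatticeModels.TorusSite 2 L) (Literature.Probability.LatticeModels.TorusSite 2 L) ℂ := fun θ x y => ((Δ₁ : ℂ) * ((if nnx x y then (1 : ℂ) else 0) - (if nny x y then (1 : ℂ) else 0)) + Complex.I * (Δ₂ : ℂ) * ((if dg1 x y then (1 : ℂ) else 0) - (if dg2 x y then (1 : ℂ) else 0))) * (Complex.exp (Complex.I * (θ x : ℂ)) + Complex.exp (Complex.I * (θ y : ℂ))) / 2; let Hb : (Literature.Probability.LatticeModels.TorusSite 2 L → ℝ) → Matrix (Literature.Probability.LatticeModels.TorusSite 2 L ⊕ Literature.Probability.LatticeModels.TorusSite 2 L) (Literature.Probability.LatticeModels.TorusSite 2 L ⊕ Literature.Probability.LatticeModels.TorusSite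 2 L) ℂ := fun θ => Matrix.fromBlocks h (D θ) (Matrix.conjTranspose (D θ)) (-h); let bc : Literature.Probability.LatticeModels.TorusSite 2 L → Literature.Probability.LatticeModels.TorusSite 2 L := fun x => ![(((x 0).val / ℓ * ℓ : ℕ) : ZMod L), (((x 1).val / ℓ * ℓ : ℕ) : ZMod L)]; let bm : (Literature.Probability.LatticeModels.TorusSite 2 L → ℝ) → Literature.Probability.LatticeModels.TorusSite 2 L → ℂ := fun θ b => (∑ x : Literature.Probability.LatticeModels.TorusSite 2 L, if bc x = b then Complex.exp (Complex.I * (θ x : ℂ)) else 0) / ((ℓ : ℂ) ^ 2); ∀ θ : Literature.Probability.LatticeModels.TorusSite 2 L → ℝ, ∀ (hθ : (Hb θ).IsHermitian) (h0 : (Hb (fun _ => 0)).IsHermitian), m * c / 4 * ∑ b : Literature.Probability.LatticeModels.TorusSite 2 L, (if bc b = b then (‖bm θ b - bm θ (b + ![((ℓ : ℕ) : ZMod L), 0])‖ ^ 2 + ‖bm θ b - bm θ (b + ![0, ((ℓ : ℕ) : ZMod L)])‖ ^ 2) else 0) ≤ ∑ i, |h0.eigenvalues i| - ∑ i, |hθ.eigenvalues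 i| := by
  intro L _ μ Δ₁ Δ₂ m c ℓ hL hℓ hdiv ξ E Δ hξ hΔ hE hm hmE hS nnx nny dg1 dg2 h D Hb bc bm θ hθ h0
  -- the texture as a unimodular field and the Lyapunov deficit bound of crux 3
  set u : TorusSite 2 L → ℂ := fun x => Complex.exp (Complex.I * (θ x : ℂ)) with hu
  have core := lyap_core μ Δ₁ Δ₂ m hL ξ E Δ hξ hΔ hE hm hmE θ hθ h0
  refine le_trans ?_ core
  -- the non-local functional of `lyap_core`, with symbol `f = Δ/E`
  set f : TorusSite 2 L → ℂ := fun k => Δ k / (E k : ℂ) with hf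
  set Q : ℝ := ∑ x : TorusSite 2 L, ∑ y : TorusSite 2 L,
      ‖(((L ^ 2 : ℕ) : ℂ)⁻¹ • ((Matrix.of fun k x : TorusSite 2 L => conj (torusChar k x))ᴴ *
          Matrix.diagonal f * Matrix.of (fun k x : TorusSite 2 L => conj (torusChar k x)))) x y‖ ^ 2 *
        ‖u y - u x‖ ^ 2 with hQ
  change m * c / 4 * _ ≤ m / 4 * Q
  have hQnn : 0 ≤ Q := by
    rw [hQ]
    exact Finset.sum_nonneg fun x _ => Finset.sum_nonneg fun y _ =>
      mul_nonneg (sq_nonneg _) (sq_nonneg _)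
  -- the block functional and its Jensen bound
  set B : ℝ := ∑ b : TorusSite 2 L, (if bc b = b then
      (‖bm θ b - bm θ (b + ![((ℓ : ℕ) : ZMod L), 0])‖ ^ 2 +
        ‖bm θ b - bm θ (b + ![0, ((ℓ : ℕ) : ZMod L)])‖ ^ 2) else 0) with hB
  have hBnn : 0 ≤ B := by
    rw [hB]
    refine Finset.sum_nonneg fun b _ => ?_
    split_ifs <;> positivity
  have hJ : B ≤ ((ℓ : ℝ) ^ 2)⁻¹ * ∑ x : TorusSite 2 L,
      (‖u x - u (x + ![((ℓ : ℕ) : ZMod L), 0])‖ ^ 2 + ‖u x - u (x + ![0, ((ℓ : ℕ) : ZMod L)])‖ ^ 2) := by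
    have := blockMis_le_shift L ℓ hℓ hdiv u
    exact this
  -- the shifted-difference functional in modes and the domination by the symbol
  have hmodes : ((ℓ : ℝ) ^ 2)⁻¹ * ∑ x : TorusSite 2 L,
      (‖u x - u (x + ![((ℓ : ℕ) : ZMod L), 0])‖ ^ 2 + ‖u x - u (x + ![0, ((ℓ : ℕ) : ZMod L)])‖ ^ 2) =
      ((L ^ 2 : ℕ) : ℝ)⁻¹ * ∑ q : TorusSite 2 L, ‖∑ x, u x * torusChar q x‖ ^ 2 *
        (((ℓ : ℝ) ^ 2)⁻¹ * (‖1 - torusChar q ![((ℓ : ℕ) : ZMod L), 0]‖ ^ 2 +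
          ‖1 - torusChar q ![0, ((ℓ : ℕ) : ZMod L)]‖ ^ 2)) := by
    rw [Finset.sum_add_distrib, sum_normSq_sub_shift_eq_modes u, sum_normSq_sub_shift_eq_modes u,
      ← mul_add, ← Finset.sum_add_distrib, ← mul_assoc, mul_comm (((ℓ : ℝ) ^ 2)⁻¹), mul_assoc,
      Finset.mul_sum]
    congr 1
    refine Finset.sum_congr rfl fun q _ => ?_
    ring
  have hdom : ((L ^ 2 : ℕ) : ℝ)⁻¹ * ∑ q : TorusSite 2 L, ‖∑ x, u x * torusChar q x‖ ^ 2 *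
      (c * (((ℓ : ℝ) ^ 2)⁻¹ * (‖1 - torusChar q ![((ℓ : ℕ) : ZMod L), 0]‖ ^ 2 +
        ‖1 - torusChar q ![0, ((ℓ : ℕ) : ZMod L)]‖ ^ 2))) ≤ Q := by
    rw [hQ]
    exact kernelFunctional_ge_of_symbol_le (d := 2) f u _ (fun q => by simpa [hf] using hS q)
  -- assemble: `c · B ≤ Q`
  have hcB : c * B ≤ Q := by
    rcases le_or_gt c 0 with hc | hc
    · exact le_trans (mul_nonpos_of_nonpos_of_nonneg hc hBnn) hQnn
    · calc c * B ≤ c * (((ℓ : ℝ) ^ 2)⁻¹ * ∑ x : TorusSite 2 L,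
            (‖u x - u (x + ![((ℓ : ℕ) : ZMod L), 0])‖ ^ 2 +
              ‖u x - u (x + ![0, ((ℓ : ℕ) : ZMod L)])‖ ^ 2)) := by gcongr
        _ = ((L ^ 2 : ℕ) : ℝ)⁻¹ * ∑ q : TorusSite 2 L, ‖∑ x, u x * torusChar q x‖ ^ 2 *
            (c * (((ℓ : ℝ) ^ 2)⁻¹ * (‖1 - torusChar q ![((ℓ : ℕ) : ZMod L), 0]‖ ^ 2 +
              ‖1 - torusChar q ![0, ((ℓ : ℕ) : ZMod L)]‖ ^ 2))) := by
            rw [hmodes, Finset.mul_sum, Finset.mul_sum, Finset.mul_sum]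
            refine Finset.sum_congr rfl fun q _ => ?_
            ring
        _ ≤ Q := hdom
  calc m * c / 4 * B = m / 4 * (c * B) := by ring
    _ ≤ m / 4 * Q := by gcongr

/-- **`BdGBlockLondonCoercivity` (card `london-block-coercivity`, first lemma) from the kernel
symbol inequality, in the card's quantifier shape.**  If for every band-interior `μ` there are a
constant `c > 0` and a smallness `Δ₀ > 0` such that for all gaps `Δ₁, Δ₂ ≠ 0` with
`|Δ₁| + |Δ₂| ≤ Δ₀` some block side `ℓ` and `L₀` make, for every `L ≥ L₀` with `ℓ ∣ L`, the symbols
`ξ, Δ, E` of side `L` obey a uniform gap `0 < m ≤ E_k` together with the kernel symbol inequality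
`4c · ℓ⁻² Σᵢ |1 - χ_q(ℓeᵢ)|² ≤ m · N⁻¹ Σ_k |f_k - f_{k+q}|²` (`f = Δ/E`) for every `q`, then the
block-London phase rigidity holds with the GAP-INDEPENDENT constant `c`:
`c · blockMis(θ) ≤ Σ|λ(Hb 0)| - Σ|λ(Hb θ)|` for every texture (`bdgRef`, `blockMisalignment` of the
card written out). [folklore] -/
theorem bdgBlockLondonCoercivity_of_kernelSymbolIneq
    (H : ∀ μ : ℝ, μ ∈ Set.Ioo (-4 : ℝ) 4 → ∃ c : ℝ, 0 < c ∧ ∃ Δ₀ : ℝ, 0 < Δ₀ ∧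
      ∀ Δ₁ Δ₂ : ℝ, Δ₁ ≠ 0 → Δ₂ ≠ 0 → |Δ₁| + |Δ₂| ≤ Δ₀ →
        ∃ ℓ : ℕ, 0 < ℓ ∧ ∃ L₀ : ℕ, ∀ (L : ℕ) [NeZero L], L₀ ≤ L → ℓ ∣ L →
          ∀ (ξ E : TorusSite 2 L → ℝ) (Δ : TorusSite 2 L → ℂ),
            (∀ k, ξ k = -2 * Real.cos (latticeMomentum L k 0) - 2 * Real.cos (latticeMomentum L k 1) - μ) →
            (∀ k, Δ k = ((2 * Δ₁ * (Real.cos (latticeMomentum L k 0) - Real.cos (latticeMomentum L k 1)) : ℝ) : ℂ) -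
              4 * Complex.I * ((Δ₂ * Real.sin (latticeMomentum L k 0) * Real.sin (latticeMomentum L k 1) : ℝ) : ℂ)) →
            (∀ k, E k = Real.sqrt (ξ k ^ 2 + ‖Δ k‖ ^ 2)) →
            ∃ m : ℝ, 0 < m ∧ (∀ k, m ≤ E k) ∧
              ∀ q : TorusSite 2 L,
                4 * c * (((ℓ : ℝ) ^ 2)⁻¹ * (‖1 - torusChar q ![((ℓ : ℕ) : ZMod L), 0]‖ ^ 2 +
                  ‖1 - torusChar q ![0, ((ℓ : ℕ) : ZMod L)]‖ ^ 2)) ≤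
                m * (((L ^ 2 : ℕ) : ℝ)⁻¹ * ∑ k : TorusSite 2 L, ‖Δ k / (E k : ℂ) - Δ (k + q) / (E (k + q) : ℂ)‖ ^ 2)) :
    ∀ μ : ℝ, μ ∈ Set.Ioo (-4 : ℝ) 4 → ∃ c : ℝ, 0 < c ∧ ∃ Δ₀ : ℝ, 0 < Δ₀ ∧
      ∀ Δ₁ Δ₂ : ℝ, Δ₁ ≠ 0 → Δ₂ ≠ 0 → |Δ₁| + |Δ₂| ≤ Δ₀ →
        ∃ ℓ : ℕ, 0 < ℓ ∧ ∃ L₀ : ℕ, ∀ (L : ℕ) [NeZero L], L₀ ≤ L → ℓ ∣ L →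
          let nnx : TorusSite 2 L → TorusSite 2 L → Prop := fun x y => y = x + ![1, 0] ∨ y = x + ![-1, 0]
          let nny : TorusSite 2 L → TorusSite 2 L → Prop := fun x y => y = x + ![0, 1] ∨ y = x + ![0, -1]
          let dg1 : TorusSite 2 L → TorusSite 2 L → Prop := fun x y => y = x + ![1, 1] ∨ y = x + ![-1, -1]
          let dg2 : TorusSite 2 L → TorusSite 2 L → Prop := fun x y => y = x + ![1, -1] ∨ y = x + ![-1, 1]
          let h : Matrix (TorusSite 2 L) (TorusSite 2 L) ℂ := fun x y =>
            -(if nnx x y ∨ nny x y then (1 : ℂ) else 0) - (if x = y then (μ : ℂ) else 0)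
          let D : (TorusSite 2 L → ℝ) → Matrix (TorusSite 2 L) (TorusSite 2 L) ℂ := fun θ x y =>
            ((Δ₁ : ℂ) * ((if nnx x y then (1 : ℂ) else 0) - (if nny x y then (1 : ℂ) else 0)) +
              Complex.I * (Δ₂ : ℂ) * ((if dg1 x y then (1 : ℂ) else 0) - (if dg2 x y then (1 : ℂ) else 0))) *
              (Complex.exp (Complex.I * (θ x : ℂ)) + Complex.exp (Complex.I * (θ y : ℂ))) / 2
          let Hb : (TorusSite 2 L → ℝ) → Matrix (TorusSite 2 L ⊕ TorusSite 2 L) (TorusSite 2 L ⊕ TorusSite 2 L) ℂ :=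
            fun θ => Matrix.fromBlocks h (D θ) (Matrix.conjTranspose (D θ)) (-h)
          let bc : TorusSite 2 L → TorusSite 2 L := fun x =>
            ![(((x 0).val / ℓ * ℓ : ℕ) : ZMod L), (((x 1).val / ℓ * ℓ : ℕ) : ZMod L)]
          let bm : (TorusSite 2 L → ℝ) → TorusSite 2 L → ℂ := fun θ b =>
            (∑ x : TorusSite 2 L, if bc x = b then Complex.exp (Complex.I * (θ x : ℂ)) else 0) / ((ℓ : ℂ) ^ 2)
          ∀ θ : TorusSite 2 L → ℝ, ∀ (hθ : (Hb θ).IsHermitian) (h0 : (Hb (fun _ => 0)).IsHermitian),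
            c * ∑ b : TorusSite 2 L, (if bc b = b then
                (‖bm θ b - bm θ (b + ![((ℓ : ℕ) : ZMod L), 0])‖ ^ 2 +
                  ‖bm θ b - bm θ (b + ![0, ((ℓ : ℕ) : ZMod L)])‖ ^ 2) else 0) ≤
              ∑ i, |h0.eigenvalues i| - ∑ i, |hθ.eigenvalues i| := by
  intro μ hμ
  obtain ⟨c, hc, Δ₀, hΔ₀, Hc⟩ := H μ hμ
  refine ⟨c, hc, Δ₀, hΔ₀, fun Δ₁ Δ₂ h₁ h₂ hsmall => ?_⟩
  obtain ⟨ℓ, hℓ, L₀, HL⟩ := Hc Δ₁ Δ₂ h₁ h₂ hsmall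
  refine ⟨ℓ, hℓ, max L₀ 3, fun L _ hL hdiv => ?_⟩
  have hL₀ : L₀ ≤ L := le_trans (le_max_left _ _) hL
  have hL3 : 3 ≤ L := le_trans (le_max_right _ _) hL
  -- the symbols at side `L`
  set ξ : TorusSite 2 L → ℝ := fun k =>
    -2 * Real.cos (latticeMomentum L k 0) - 2 * Real.cos (latticeMomentum L k 1) - μ with hξ
  set Δ : TorusSite 2 L → ℂ := fun k =>
    ((2 * Δ₁ * (Real.cos (latticeMomentum L k 0) - Real.cos (latticeMomentum L k 1)) : ℝ) : ℂ) -
      4 * Complex.I * ((Δ₂ * Real.sin (latticeMomentum L k 0) * Real.sin (latticeMomentum L k 1) : ℝ) : ℂ)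
    with hΔ
  set E : TorusSite 2 L → ℝ := fun k => Real.sqrt (ξ k ^ 2 + ‖Δ k‖ ^ 2) with hE
  obtain ⟨m, hm, hmE, hS⟩ := HL L hL₀ hdiv ξ E Δ (fun _ => rfl) (fun _ => rfl) (fun _ => rfl)
  -- the symbol inequality with constant `4c/m`
  have hS' : ∀ q : TorusSite 2 L, 4 * c / m * (((ℓ : ℝ) ^ 2)⁻¹ *
      (‖1 - torusChar q ![((ℓ : ℕ) : ZMod L), 0]‖ ^ 2 + ‖1 - torusChar q ![0, ((ℓ : ℕ) : ZMod L)]‖ ^ 2)) ≤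
      ((L ^ 2 : ℕ) : ℝ)⁻¹ * ∑ k : TorusSite 2 L, ‖Δ k / (E k : ℂ) - Δ (k + q) / (E (k + q) : ℂ)‖ ^ 2 := by
    intro q
    rw [div_mul_eq_mul_div, div_le_iff₀ hm, mul_comm _ m]
    exact hS q
  have main := blockLondon_of_kernelSymbolIneq L μ Δ₁ Δ₂ m (4 * c / m) ℓ hL3 hℓ hdiv ξ E Δ
    (fun _ => rfl) (fun _ => rfl) (fun _ => rfl) hm hmE hS'
  intro nnx nny dg1 dg2 h D Hb bc bm θ hθ h0
  have key := main θ hθ h0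
  have hconst : m * (4 * c / m) / 4 = c := by field_simp
  rw [hconst] at key
  exact key

end BirBdG

end Summit.HubbardSuperconductivity.HubbardSuperconductivity.Theorems

end
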